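import Literature.InformationTheory.Entanglement.TwoRebitSeparabilityProbabilityProofs
import Literature.Probability.RandomMatrix.TwoQubitSeparabilityVolumesRebitHolds
import HarnessLib

/-!
# Two-rebit separability probability `29/64` (Lovas–Andai 2017, Theorem 2): the discharge

Sibling proof file of `Literature/InformationTheory/Entanglement/TwoRebitSeparabilityProbability.lean`.
Theorem-only; nothing is defined here. It discharges the named fact

* `LovasAndai2017_rebit_2964 : 64 · λ₉(P_ℝ) = 29 · λ₉(D_ℝ)` (closed bodies `rebitPPTBody ⊆ rebitStateBody`,
  `Matrix.PosSemidef` typing)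

by combining two theorems already in the tree:

* `LovasAndai2017_rebit_2964_iff_posDef` (`…/TwoRebitSeparabilityProbabilityProofs.lean`): the
  closed-body typing is equivalent to the open-body (faithful-state, `Matrix.PosDef`) typing
  `Literature.Probability.RandomMatrix.LovasAndai2017_rebit_separability_probability` — the frontier
  of a convex body is Lebesgue-null;
* `Literature.Probability.RandomMatrix.LovasAndai2017_rebit_separability_probability_holds`
  (`Literature/Probability/RandomMatrix/TwoQubitSeparabilityVolumesRebitHolds.lean`): the open-body
  Theorem 2, proved along the printed architecture — Corollary 2 (reduction to the fibre over the
  maximally mixed marginal, `…RebitFullProofs.lean`), the fibre reduction to the eigen-pair double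
  integral (`…RebitFibreReduction.lean`), Lemma 6 (the defect function `χ̃₁`, `LovasAndaiLemma6.lean`)
  and the dilogarithmic evaluation `∫∫ χ̃₁ · w = ¼ · (29/64)·(64/35)…` of the proof of Theorem 2
  (`LovasAndaiTheorem2Kernel.lean`, `…RebitHolds.lean`).

## References

* [LovasAndai2017] A. Lovas, A. Andai, *Invariance of separability probability over reduced states
  in 4 × 4 bipartite systems*, J. Phys. A 50 (2017) 295303, arXiv:1610.01410: Theorem 2 (p. 8,
  `𝒫_sep(ℝ) = 29/64`), Corollary 2, Lemma 6 (Appendix A).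
-/

noncomputable section

namespace Literature.InformationTheory.Entanglement

/-- **Lovas–Andai 2017, Theorem 2 (two-rebit Hilbert–Schmidt separability probability `29/64`),
discharged**: `64 · λ₉(P_ℝ) = 29 · λ₉(D_ℝ)` for the closed two-rebit bodies in the affine chart
`rebitDensity`. Proof: the closed-body statement is equivalent to the open-body one
(`LovasAndai2017_rebit_2964_iff_posDef`), which is the theorem
`Literature.Probability.RandomMatrix.LovasAndai2017_rebit_separability_probability_holds`.
[cite: LovasAndai2017, Theorem 2 (with Corollary 2 and Lemma 6 for the proof)] -/
theorem LovasAndai2017_rebit_2964_holds : LovasAndai2017_rebit_2964 :=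
  LovasAndai2017_rebit_2964_iff_posDef.2
    Literature.Probability.RandomMatrix.LovasAndai2017_rebit_separability_probability_holds

/-- The separability probability as a number: `vol(P_ℝ) / vol(D_ℝ) = 29/64` (real volumes of the
closed two-rebit bodies), unconditionally. [cite: LovasAndai2017, Theorem 2] -/
theorem rebit_separability_probability_eq :
    (MeasureTheory.volume rebitPPTBody).toReal / (MeasureTheory.volume rebitStateBody).toReal
      = 29 / 64 :=
  LovasAndai2017_rebit_2964_holds.div_eq
    (ENNReal.toReal_ne_zero.2
      ⟨volume_rebitStateBody_eq_posDef ▸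
          Literature.Probability.RandomMatrix.LovasAndai2017.volume_posDef_twoRebit_pos.ne',
        volume_rebitStateBody_lt_top.ne⟩)

end Literature.InformationTheory.Entanglement

end
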